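import Summits.SmoothPoincare4.SmoothPoincare4.Theses.SymplecticOrigami
import Literature.Topology.FourManifolds.HomotopySpheres
import Literature.Topology.FourManifolds.Diffeotopy

/-!
# Birth skeleton of piece X₂ `StableSeam` (split of crux `OrigamiFoldExistence`, stmt-SmoothPoincare4-7844)

X₂ = any host embedding `J` of (a neighbourhood of) the fake ball `Δ_e` of a homotopy 4-sphere into a
rational host `(X, Ω)` can be replaced, IN THE SAME HOST, by one `J'` whose seam trace
`(J' ∘ e)|_{S³}^* Ω` is STABILISABLE (Hofer–Zehnder / Cieliebak–Volkov).  Verbatim the registered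
`stub_stableSeam` of line `stable-seam-host` (the FLEXIBLE half of the zero slack).

PLAN (three stubs; the first is the research content, the other two are the formal transport the
composition needs — each M-sized in the kernel, cf. the landed `Negative.foldData_transport`):
* `stub_stableRepresentative` [STABLE REPRESENTATIVE, exotica-free, OPEN; the research stub] —
  in a closed symplectic `ℝ⁴`-charted `(X, Ω)`, every smoothly embedded 3-sphere that extends to an
  embedding of a shell (`g : ℝ⁴ → X`, an injective immersion `C^∞` on an open `V ⊇ S³`) is moved
  by a diffeomorphism `φ` of `X` DIFFEOTOPIC TO THE IDENTITY (tree
  `Literature.Topology.FourManifolds.Diffeomorph.IsDiffeotopicToId`) to one whose trace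
  `(φ ∘ g)|_{S³}^* Ω` admits a stabilising 1-form `θ` (`θ ∧ σ ≠ 0`, `ker σ ⊂ ker dθ`).  This is the
  "stable representative in every isotopy class of hypersurfaces" question (SR) that lead c8's
  worker B calibrated (CALIBRATION-c8 §6): NOT addressed in print — Cardona 2023 (arXiv:2305.13158,
  p. 5; Thm 1: stability is neither open nor closed nor generic in dimension 4 in every isotopy
  class), Cardona–Gironella 2025 (arXiv:2407.01357, intro); no existence or non-existence theorem;
  the symplectic twin of Honda–Huang 2019 (C⁰-dense convex hypersurfaces in contact manifolds).
  It is SR for 3-SPHERES only, and it discharges X₂ for every `S` at once (`J' := φ ∘ J`).  Why it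
  might fail: an isotopy class of embedded `S³`'s all of whose members carry a non-stabilisable
  (e.g. robustly non-geodesible, Sullivan 1978) characteristic foliation — a new rigidity
  phenomenon in stable Hamiltonian topology; the piece X₂ would survive it (X₂ needs SR only for
  seams of fake balls, and allows re-embeddings that are not ambient-isotopic).
* `stub_reembedAlongDiffeo` [transport, formal M] — composing a fake-ball-neighbourhood embedding
  `J` with a diffeomorphism `φ` of the host gives one (`φ ∘ J`): chain rule for `mfderiv`,
  injectivity, preimage of the open set.
* `stub_seamShell` [transport, formal M] — for such a `J` and a chart ball `e` (a smooth embedding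
  `ℝ⁴ → S`), `J ∘ e` is a shell embedding of `S³` (`C^∞`, injective, immersive on the open
  `e⁻¹(U) ⊇ S³`).
* Composition `StableSeam_of` — apply SR to `g := J ∘ e`, set `J' := φ ∘ J` (the two spellings
  `(φ ∘ J) ∘ e` and `φ ∘ (J ∘ e)` agree definitionally).

BC3 probes (bc/StableSeam_birth_probe.lean): no stub gives X₂ or SmoothPoincare4 under `exact? | aesop`.
-/

noncomputable section

-- the prescribed namespace `Summit.<P>.<Sub>.…` duplicates `SmoothPoincare4` (P = Sub)
set_option linter.dupNamespace false

open scoped Manifold ContDiff Topology RealInnerProductSpace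
open Set Function TopologicalSpace ContinuousMap

/-! ### The piece(s), declared LOCALLY in the route namespace exactly as the gate will render them
after `route edit --split` (pre-split draft; the published version imports the route file instead) -/

namespace Summit.SmoothPoincare4.SmoothPoincare4.Theses.SymplecticOrigami

/-- piece StableSeam (= registered `stub_stableSeam` of line stable-seam-host, verbatim). -/
def StableSeam : Prop :=
  ∀ (S : Literature.Topology.FourManifolds.HomotopySphere 4) (e : EuclideanSpace ℝ (Fin 4) → S.carrier) (X : Type) [TopologicalSpace X] [T2Space X] [SecondCountableTopology X] [CompactSpace X] [ChartedSpace (EuclideanSpace ℝ (Fin 4)) X] [IsManifold (𝓡 4) ∞ X] [SimplyConnectedSpace X] (Ω : Literature.Geometry.Kaehler.MForm (𝓡 4) X ℝ 2) (J : S.carrier → X) (c c' : (Metric.sphere (0 : EuclideanSpace ℝ (Fin 3)) 1) → X), Manifold.IsSmoothEmbedding (𝓡 4) (𝓡 4) ∞ e → (Literature.Geometry.Kaehler.IsSmoothForm Ω ∧ Literature.Geometry.Kaehler.IsClosedForm Ω ∧ ∀ x (v : TangentSpace (𝓡 4) x), v ≠ 0 → ∃ w, Ω x ![v, w] ≠ 0)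 → (∃ U : Set S.carrier, IsOpen U ∧ (e '' Metric.ball (0 : EuclideanSpace ℝ (Fin 4)) 1)ᶜ ⊆ U ∧ ContMDiffOn (𝓡 4) (𝓡 4) ∞ J U ∧ Set.InjOn J U ∧ ∀ x ∈ U, Function.Bijective (mfderiv (𝓡 4) (𝓡 4) J x)) → (Manifold.IsSmoothEmbedding (𝓡 2) (𝓡 4) ∞ c ∧ (∀ y (v : TangentSpace (𝓡 2) y), v ≠ 0 → ∃ w : TangentSpace (𝓡 2) y, Ω (c y) ![mfderiv (𝓡 2) (𝓡 4) c y v, mfderiv (𝓡 2) (𝓡 4) c y w] ≠ 0) ∧ Manifold.IsSmoothEmbedding (𝓡 2) (𝓡 4) ∞ c' ∧ Disjoint (Set.range c) (Set.range c') ∧ ∃ H : unitInterval × (Metric.sphere (0 : EuclideanSpace ℝ (Fin 3)) 1) → X, Continuous H ∧ ∀ y, H (0, y) = c y ∧ H (1, y) = c' y) → ∃ (J' : S.carrier → X) (θ : EuclideanSpace ℝ (Fin 4) → EuclideanSpace ℝ (Fin 4) →L[ℝ] ℝ), (∃ U : Set S.carrier, IsOpen U ∧ (e '' Metric.ball (0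 : EuclideanSpace ℝ (Fin 4)) 1)ᶜ ⊆ U ∧ ContMDiffOn (𝓡 4) (𝓡 4) ∞ J' U ∧ Set.InjOn J' U ∧ ∀ x ∈ U, Function.Bijective (mfderiv (𝓡 4) (𝓡 4) J' x)) ∧ (ContDiff ℝ ∞ θ ∧ (∀ u : EuclideanSpace ℝ (Fin 4), ‖u‖ = 1 → ∀ v : Fin 3 → EuclideanSpace ℝ (Fin 4), (∀ i, ⟪v i, u⟫ = 0) → LinearIndependent ℝ v → θ u (v 0) * Ω ((J' ∘ e) u) ![mfderiv (𝓡 4) (𝓡 4) (J' ∘ e) u (v 1), mfderiv (𝓡 4) (𝓡 4) (J' ∘ e) u (v 2)] - θ u (v 1) * Ω ((J' ∘ e) u) ![mfderiv (𝓡 4) (𝓡 4) (J' ∘ e) u (v 0), mfderiv (𝓡 4) (𝓡 4) (J' ∘ e) u (v 2)] + θ u (v 2) * Ω ((J' ∘ e) u) ![mfderiv (𝓡 4) (𝓡 4) (J' ∘ e) u (v 0), mfderiv (𝓡 4) (𝓡 4) (J' ∘ e) u (v 1)] ≠ 0) ∧ (∀ u : EuclideanSpace ℝ (Fin 4), ‖u‖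 = 1 → ∀ v : EuclideanSpace ℝ (Fin 4), ⟪v, u⟫ = 0 → (∀ w : EuclideanSpace ℝ (Fin 4), ⟪w, u⟫ = 0 → Ω ((J' ∘ e) u) ![mfderiv (𝓡 4) (𝓡 4) (J' ∘ e) u v, mfderiv (𝓡 4) (𝓡 4) (J' ∘ e) u w] = 0) → ∀ w : EuclideanSpace ℝ (Fin 4), ⟪w, u⟫ = 0 → fderiv ℝ θ u v w - fderiv ℝ θ u w v = 0))

end Summit.SmoothPoincare4.SmoothPoincare4.Theses.SymplecticOrigami

namespace Summit.SmoothPoincare4.SmoothPoincare4.Cruxes.StableSeam.Birth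

open Summit.SmoothPoincare4.SmoothPoincare4.Theses.SymplecticOrigami (StableSeam)

/-- Statement of stub 1 [SR for 3-spheres: a stable representative in every isotopy class]. -/
def StableRepresentative : Prop :=
  ∀ (X : Type) [TopologicalSpace X] [T2Space X] [SecondCountableTopology X] [CompactSpace X] [ChartedSpace (EuclideanSpace ℝ (Fin 4)) X] [IsManifold (𝓡 4) ∞ X] (Ω : Literature.Geometry.Kaehler.MForm (𝓡 4) X ℝ 2) (g : EuclideanSpace ℝ (Fin 4) → X), (Literature.Geometry.Kaehler.IsSmoothForm Ω ∧ Literature.Geometry.Kaehler.IsClosedForm Ω ∧ ∀ x (v : TangentSpace (𝓡 4) x), v ≠ 0 → ∃ w, Ω x ![v, w] ≠ 0) → (∃ V : Set (EuclideanSpace ℝ (Fin 4)), IsOpen V ∧ Metric.sphere (0 : EuclideanSpace ℝ (Fin 4)) 1 ⊆ V ∧ ContMDiffOn (𝓡 4) (𝓡 4) ∞ g V ∧ Set.InjOn g V ∧ ∀ u ∈ V, Function.Bijective (mfderiv (𝓡 4) (𝓡 4) g u)) → ∃ (φ : X ≃ₘ⟮𝓡 4, 𝓡 4⟯ X) (θ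 : EuclideanSpace ℝ (Fin 4) → EuclideanSpace ℝ (Fin 4) →L[ℝ] ℝ), Literature.Topology.FourManifolds.Diffeomorph.IsDiffeotopicToId φ ∧ (ContDiff ℝ ∞ θ ∧ (∀ u : EuclideanSpace ℝ (Fin 4), ‖u‖ = 1 → ∀ v : Fin 3 → EuclideanSpace ℝ (Fin 4), (∀ i, ⟪v i, u⟫ = 0) → LinearIndependent ℝ v → θ u (v 0) * Ω ((φ ∘ g) u) ![mfderiv (𝓡 4) (𝓡 4) (φ ∘ g) u (v 1), mfderiv (𝓡 4) (𝓡 4) (φ ∘ g) u (v 2)] - θ u (v 1) * Ω ((φ ∘ g) u) ![mfderiv (𝓡 4) (𝓡 4) (φ ∘ g) u (v 0), mfderiv (𝓡 4) (𝓡 4) (φ ∘ g) u (v 2)] + θ u (v 2) * Ω ((φ ∘ g) u) ![mfderiv (𝓡 4) (𝓡 4) (φ ∘ g) u (v 0), mfderiv (𝓡 4) (𝓡 4) (φ ∘ g) u (v 1)] ≠ 0) ∧ (∀ u : EuclideanSpace ℝ (Fin 4), ‖u‖ = 1 → ∀ v : EuclideanSpace ℝ (Fin 4), ⟪v, u⟫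 = 0 → (∀ w : EuclideanSpace ℝ (Fin 4), ⟪w, u⟫ = 0 → Ω ((φ ∘ g) u) ![mfderiv (𝓡 4) (𝓡 4) (φ ∘ g) u v, mfderiv (𝓡 4) (𝓡 4) (φ ∘ g) u w] = 0) → ∀ w : EuclideanSpace ℝ (Fin 4), ⟪w, u⟫ = 0 → fderiv ℝ θ u v w - fderiv ℝ θ u w v = 0))

/-- Statement of stub 2 [transport of a fake-ball-neighbourhood embedding along a host diffeomorphism]. -/
def ReembedAlongDiffeo : Prop :=
  ∀ (S : Literature.Topology.FourManifolds.HomotopySphere 4) (e : EuclideanSpace ℝ (Fin 4) → S.carrier) (X : Type) [TopologicalSpace X] [ChartedSpace (EuclideanSpace ℝ (Fin 4)) X] [IsManifold (𝓡 4) ∞ X] (J : S.carrier → X) (φ : X ≃ₘ⟮𝓡 4, 𝓡 4⟯ X), (∃ U : Set S.carrier, IsOpen U ∧ (e '' Metric.ball (0 : EuclideanSpace ℝ (Fin 4)) 1)ᶜ ⊆ U ∧ ContMDiffOn (𝓡 4) (𝓡 4) ∞ J U ∧ Set.InjOn J U ∧ ∀ x ∈ U, Function.Bijective (mfderiv (𝓡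 4) (𝓡 4) J x)) → (∃ U : Set S.carrier, IsOpen U ∧ (e '' Metric.ball (0 : EuclideanSpace ℝ (Fin 4)) 1)ᶜ ⊆ U ∧ ContMDiffOn (𝓡 4) (𝓡 4) ∞ (φ ∘ J) U ∧ Set.InjOn (φ ∘ J) U ∧ ∀ x ∈ U, Function.Bijective (mfderiv (𝓡 4) (𝓡 4) (φ ∘ J) x))

/-- Statement of stub 3 [the seam of a host embedding is a shell embedding of `S³`]. -/
def SeamShell : Prop :=
  ∀ (S : Literature.Topology.FourManifolds.HomotopySphere 4) (e : EuclideanSpace ℝ (Fin 4) → S.carrier) (X : Type) [TopologicalSpace X] [ChartedSpace (EuclideanSpace ℝ (Fin 4)) X] [IsManifold (𝓡 4) ∞ X] (J : S.carrier → X), Manifold.IsSmoothEmbedding (𝓡 4) (𝓡 4) ∞ e → (∃ U : Set S.carrier, IsOpen U ∧ (e '' Metric.ball (0 : EuclideanSpace ℝ (Fin 4)) 1)ᶜ ⊆ U ∧ ContMDiffOn (𝓡 4) (𝓡 4) ∞ J U ∧ Set.InjOn J U ∧ ∀ x ∈ U, Function.Bijective (mfderiv (𝓡 4) (𝓡 4)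 J x)) → (∃ V : Set (EuclideanSpace ℝ (Fin 4)), IsOpen V ∧ Metric.sphere (0 : EuclideanSpace ℝ (Fin 4)) 1 ⊆ V ∧ ContMDiffOn (𝓡 4) (𝓡 4) ∞ (J ∘ e) V ∧ Set.InjOn (J ∘ e) V ∧ ∀ u ∈ V, Function.Bijective (mfderiv (𝓡 4) (𝓡 4) (J ∘ e) u))

/-- STUB 1 [STABLE REPRESENTATIVE FOR 3-SPHERES] (open, flexible stable Hamiltonian topology;
exotica-free; the research stub of X₂).  In a closed symplectic `ℝ⁴`-charted `(X, Ω)` every shell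
embedding `g` of `S³` is moved by a diffeomorphism `φ` diffeotopic to the identity to one whose
trace is stabilisable (`θ ∧ σ ≠ 0` on `TS³`, `ker σ ⊂ ker dθ`).  Not addressed in print (Cardona
2023 arXiv:2305.13158 Thm 1 / p. 5; Cardona–Gironella 2025 arXiv:2407.01357): stability is neither
open nor closed nor generic; inputs: the 0-parametric h-principle for SHS in dimension 3 and open
books (Cieliebak–Volkov 2015 Thm 1.6, Prop prop:ex), the pointwise surjectivity
`T_Y X → T^*Y, V ↦ ι_V Ω|_TY` (exact deformations of the trace = motions through IMMERSED
hypersurfaces; Moser along the hypersurface: Cardona 2023 App. A Lemma 49), wrinkled embeddings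
(Eliashberg–Mishachev 2009) as the only printed engine moving a hypersurface C⁰-little and
C¹-much.  Why it might fail: an isotopy class of embedded 3-spheres all carrying robustly
non-stabilisable characteristic foliations (Sullivan 1978 non-geodesibility made C⁰-robust).
Sources: arXiv:2305.13158, arXiv:2407.01357, arXiv:1003.5084, arXiv:0903.0700, HoferZehnder1994,
HondaHuang2019, EliashbergMishachev2009, Sullivan1978. -/
theorem stub_stableRepresentative :
    ∀ (X : Type) [TopologicalSpace X] [T2Space X] [SecondCountableTopology X] [CompactSpace X] [ChartedSpace (EuclideanSpace ℝ (Fin 4)) X] [IsManifold (𝓡 4) ∞ X] (Ω : Literature.Geometry.Kaehler.MForm (𝓡 4) X ℝ 2) (g : EuclideanSpace ℝ (Fin 4) → X), (Literature.Geometry.Kaehler.IsSmoothForm Ω ∧ Literature.Geometry.Kaehler.IsClosedForm Ω ∧ ∀ x (v : TangentSpace (𝓡 4) x), v ≠ 0 → ∃ w, Ω x ![v, w] ≠ 0) → (∃ V : Set (EuclideanSpace ℝ (Fin 4)), IsOpen V ∧ Metric.sphere (0 : EuclideanSpace ℝ (Fin 4)) 1 ⊆ V ∧ ContMDiffOn (𝓡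 4) (𝓡 4) ∞ g V ∧ Set.InjOn g V ∧ ∀ u ∈ V, Function.Bijective (mfderiv (𝓡 4) (𝓡 4) g u)) → ∃ (φ : X ≃ₘ⟮𝓡 4, 𝓡 4⟯ X) (θ : EuclideanSpace ℝ (Fin 4) → EuclideanSpace ℝ (Fin 4) →L[ℝ] ℝ), Literature.Topology.FourManifolds.Diffeomorph.IsDiffeotopicToId φ ∧ (ContDiff ℝ ∞ θ ∧ (∀ u : EuclideanSpace ℝ (Fin 4), ‖u‖ = 1 → ∀ v : Fin 3 → EuclideanSpace ℝ (Fin 4), (∀ i, ⟪v i, u⟫ = 0) → LinearIndependent ℝ v → θ u (v 0) * Ω ((φ ∘ g) u) ![mfderiv (𝓡 4) (𝓡 4) (φ ∘ g) u (v 1), mfderiv (𝓡 4) (𝓡 4) (φ ∘ g) u (v 2)] - θ u (v 1) * Ω ((φ ∘ g) u) ![mfderiv (𝓡 4) (𝓡 4) (φ ∘ g) u (v 0), mfderiv (𝓡 4) (𝓡 4) (φ ∘ g) u (v 2)] + θ u (v 2) * Ω ((φ ∘ g) u) ![mfderiv (𝓡 4) (𝓡 4) (φ ∘ g) u (v 0),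 mfderiv (𝓡 4) (𝓡 4) (φ ∘ g) u (v 1)] ≠ 0) ∧ (∀ u : EuclideanSpace ℝ (Fin 4), ‖u‖ = 1 → ∀ v : EuclideanSpace ℝ (Fin 4), ⟪v, u⟫ = 0 → (∀ w : EuclideanSpace ℝ (Fin 4), ⟪w, u⟫ = 0 → Ω ((φ ∘ g) u) ![mfderiv (𝓡 4) (𝓡 4) (φ ∘ g) u v, mfderiv (𝓡 4) (𝓡 4) (φ ∘ g) u w] = 0) → ∀ w : EuclideanSpace ℝ (Fin 4), ⟪w, u⟫ = 0 → fderiv ℝ θ u v w - fderiv ℝ θ u w v = 0)) := by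
  sorry

/-- STUB 2 [RE-EMBEDDING ALONG A HOST DIFFEOMORPHISM] (formal, M-sized: `mfderiv` chain rule with
a diffeomorphism, injectivity of a composite, the same open `U`).  Sources: folklore (cf. the landed
`Negative.foldData_transport`, p72874, for the pattern). -/
theorem stub_reembedAlongDiffeo :
    ∀ (S : Literature.Topology.FourManifolds.HomotopySphere 4) (e : EuclideanSpace ℝ (Fin 4) → S.carrier) (X : Type) [TopologicalSpace X] [ChartedSpace (EuclideanSpace ℝ (Fin 4)) X] [IsManifold (𝓡 4) ∞ X] (J : S.carrier → X) (φ : X ≃ₘ⟮𝓡 4, 𝓡 4⟯ X), (∃ U : Set S.carrier, IsOpen U ∧ (e '' Metric.ball (0 : EuclideanSpace ℝ (Fin 4)) 1)ᶜ ⊆ U ∧ ContMDiffOn (𝓡 4) (𝓡 4) ∞ J U ∧ Set.InjOn J U ∧ ∀ x ∈ U, Function.Bijective (mfderiv (𝓡 4) (𝓡 4) J x)) → (∃ U : Set S.carrier, IsOpen U ∧ (e '' Metric.ball (0 : EuclideanSpace ℝ (Fin 4)) 1)ᶜ ⊆ U ∧ ContMDiffOn (𝓡 4) (𝓡 4) ∞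 (φ ∘ J) U ∧ Set.InjOn (φ ∘ J) U ∧ ∀ x ∈ U, Function.Bijective (mfderiv (𝓡 4) (𝓡 4) (φ ∘ J) x)) := by
  sorry

/-- STUB 3 [THE SEAM IS A SHELL EMBEDDING] (formal, M-sized: `J ∘ e` is `C^∞`, injective and
immersive on the open `e ⁻¹' U ⊇ S³`, by the chain rule and `Manifold.IsSmoothEmbedding e`).
Sources: folklore. -/
theorem stub_seamShell :
    ∀ (S : Literature.Topology.FourManifolds.HomotopySphere 4) (e : EuclideanSpace ℝ (Fin 4) → S.carrier) (X : Type) [TopologicalSpace X] [ChartedSpace (EuclideanSpace ℝ (Fin 4)) X] [IsManifold (𝓡 4) ∞ X] (J : S.carrier → X), Manifold.IsSmoothEmbedding (𝓡 4) (𝓡 4) ∞ e → (∃ U : Set S.carrier, IsOpen U ∧ (e '' Metric.ball (0 : EuclideanSpace ℝ (Fin 4)) 1)ᶜ ⊆ U ∧ ContMDiffOn (𝓡 4) (𝓡 4) ∞ J U ∧ Set.InjOn J U ∧ ∀ x ∈ U, Function.Bijective (mfderiv (𝓡 4) (𝓡 4) J x)) → (∃ V : Set (EuclideanSpace ℝ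 (Fin 4)), IsOpen V ∧ Metric.sphere (0 : EuclideanSpace ℝ (Fin 4)) 1 ⊆ V ∧ ContMDiffOn (𝓡 4) (𝓡 4) ∞ (J ∘ e) V ∧ Set.InjOn (J ∘ e) V ∧ ∀ u ∈ V, Function.Bijective (mfderiv (𝓡 4) (𝓡 4) (J ∘ e) u)) := by
  sorry

/-! ### Consistency: the named statements ARE the stubs -/

theorem stableRepresentative_holds : StableRepresentative := stub_stableRepresentative
theorem reembedAlongDiffeo_holds : ReembedAlongDiffeo := stub_reembedAlongDiffeo
theorem seamShell_holds : SeamShell := stub_seamShell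

/-! ### Composition (pure logic, no `sorry`) -/

/-- `StableSeam` from the three stubs, BY NAME: SR applied to the seam `g := J ∘ e`, then
`J' := φ ∘ J`. -/
theorem StableSeam_of (hSR : StableRepresentative) (hT : ReembedAlongDiffeo) (hSh : SeamShell) :
    StableSeam := by
  intro S e X _ _ _ _ _ _ _ Ω J c c' he hΩ hJ hc
  obtain ⟨φ, θ, -, hθ⟩ := hSR X Ω (J ∘ e) hΩ (hSh S e X J he hJ)
  exact ⟨φ ∘ J, θ, hT S e X J φ hJ, hθ⟩

/-- Wiring check. -/
example : StableSeam := StableSeam_of stub_stableRepresentative stub_reembedAlongDiffeo stub_seamShell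

end Summit.SmoothPoincare4.SmoothPoincare4.Cruxes.StableSeam.Birth

end
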